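import Summits.FinalStateConjecture.FinalStateConjecture.Theses.PhaseMixingCapture
import Literature.Geometry.Lorentzian.TameGenericityDiagonal
import Literature.Geometry.Lorentzian.AdiabaticTracking

/-!
# `CaptureSufficesC2` (stmt-FinalStateConjecture-14986, route PhaseMixingCapture, rank 6):
# reduction to the tame layer-2 statements along censored curves

Line `censorship-enters-diagonally` of the crux (skeleton
`Cruxes/CaptureSufficesC2/Lines/censorship_enters_diagonally.lean`, v2). The crux is the conditional
`NearExtremalKappaCapture → BulkKerrCaptureC2 → WeakCosmicCensorshipMGHD → FinalStateConjecture`; since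
the 2026-08-16T21:18Z re-typing of the summit (TAME genericity `IsTameChristodoulouGeneric`,
`RaysStayInClosure`, `IsFutureOriented`) its three hypotheses are idle as typed (rank 5 carries the old
topology-free genericity; ranks 2/4 hand over an unpinned `∃𝒟oc` chart, `CaptureSufficesC2.Negative.ChartForm`),
so a closing line must prove the summit from layer-2 statements of its own. This file is the
REDUCTION THEOREM of the line, sorry-free and definition-free (playbook: reduction first, hypotheses =
the registered stub texts verbatim):

* `finalStateConjecture_of_tameLayer` — the re-typed summit from the four registered stubs of the line:
  (1) TAME weak cosmic censorship in MGHD form (`stub_tameCensorship` = rank 5 with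
  `IsChristodoulouGeneric ↦ IsTameChristodoulouGeneric`); (2) along every tame admissible curve of
  censored data (immersed-injective or constant, base arbitrary) a tame injective immersed admissible
  curve through the same base datum whose members off `0` are censored and QUIET — every MGHD
  adiabatically tracked (`VacuumCauchyDevelopment.IsAdiabaticallyTracked`) at every accuracy, complexity
  free (`stub_quietAlongCensoredCurves`); (3) the same from quiet curves to MARGIN members — one
  complexity `(N, m₀, χ < 1)` for all accuracies (`stub_marginAlongQuietCurves`); (4) pointwise
  all-accuracy drift capture — a censored MGHD tracked at every accuracy with one complexity settles as
  the summit demands (`stub_trackedCaptureSettles`). Proof: two applications of the composition of tame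
  genericities along curves (`InitialDataSet.isTameChristodoulouGeneric_of_relative`,
  `Literature/Geometry/Lorentzian/TameGenericityDiagonal.lean`) and one `IsTameChristodoulouGeneric.mono`.
* `captureSufficesC2_of_tameLayer` — hence the crux BY NAME (its hypotheses introduced and dropped).
* `weakCosmicCensorshipMGHD_of_tameCensorship` — hypothesis (1) STRENGTHENS rank 5 as typed;
  `tameCensorship_of_finalStateConjecture` — and is implied by the summit (necessary, as rank 5 was).

Nothing here is analysis: hypotheses (2)–(4) carry the dynamical content of the final state conjecture
(no eternal non-Kerr vacuum dynamics along generic kicks; no parking at extremality; orbital ⇒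
asymptotic stability) and (1) is weak cosmic censorship in Christodoulou's own tame sense.
-/

-- the doubled `FinalStateConjecture.FinalStateConjecture` path component trips dupNamespace
set_option linter.dupNamespace false

noncomputable section

open scoped Manifold ContDiff Topology ENNReal
open Set Function

namespace Summit.FinalStateConjecture.FinalStateConjecture.Theorems.PhaseMixingCaptureCaptureSufficesC2

open Literature.Geometry.Lorentzian
open Summit.FinalStateConjecture.FinalStateConjecture.Theses.PhaseMixingCapture
  (NearExtremalKappaCapture BulkKerrCaptureC2 WeakCosmicCensorshipMGHD CaptureSufficesC2)

/-- **The re-typed summit from the tame layer along censored curves.** Hypotheses, verbatim the four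
registered stubs of line `censorship-enters-diagonally`: `h₅` tame weak cosmic censorship (MGHD form);
`h₁` quiet curve witnesses along censored curves; `h₂` margin curve witnesses along quiet curves; `h₃`
pointwise all-accuracy drift capture. Conclusion: `FinalStateConjecture`. Tame-generic censorship ⟹
tame-generic quiet (composition along curves) ⟹ tame-generic margin (composition along curves) ⟹
tame-generic settling (`mono` with `h₃`). [folklore] -/
theorem finalStateConjecture_of_tameLayer
    (h₅ : ∀ (X : Type) [TopologicalSpace X] [ChartedSpace E3 X] [IsManifold (𝓡 3) ∞ X] [T2Space X]
      [SecondCountableTopology X] [ConnectedSpace X],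
      InitialDataSet.IsTameChristodoulouGeneric (admissibleVacuumData X)
        (fun D ↦ (∃ 𝒟 : VacuumCauchyDevelopment D, 𝒟.IsMaximal) ∧
          ∀ 𝒟 : VacuumCauchyDevelopment D, 𝒟.IsMaximal →
            Summit.FinalStateConjecture.HasCompleteNullInfinity 𝒟.toCauchyDevelopment) 1)
    (h₁ : ∀ (X : Type) [TopologicalSpace X] [ChartedSpace E3 X] [IsManifold (𝓡 3) ∞ X] [T2Space X]
      [SecondCountableTopology X] [ConnectedSpace X],
      ∀ (e : AFEnd X) (F : EuclideanSpace ℝ (Fin 1) → InitialDataSet (𝓡 3) X),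
        InitialDataSet.IsTameDataFamily e 1 F →
          ((InitialDataSet.IsImmersedAtZero 1 F ∧ Function.Injective F) ∨ ∀ c, F c = F 0) →
          (∀ c, F c ∈ admissibleVacuumData X) →
          (∀ c ≠ 0, (∃ 𝒟 : VacuumCauchyDevelopment (F c), 𝒟.IsMaximal) ∧
            ∀ 𝒟 : VacuumCauchyDevelopment (F c), 𝒟.IsMaximal →
              Summit.FinalStateConjecture.HasCompleteNullInfinity 𝒟.toCauchyDevelopment) →
          ∃ F' : EuclideanSpace ℝ (Fin 1) → InitialDataSet (𝓡 3) X,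
            InitialDataSet.IsTameDataFamily e 1 F' ∧ F' 0 = F 0 ∧ Function.Injective F' ∧
              InitialDataSet.IsImmersedAtZero 1 F' ∧ (∀ c, F' c ∈ admissibleVacuumData X) ∧
              ∀ c : EuclideanSpace ℝ (Fin 1), c ≠ 0 →
                ((∃ 𝒟 : VacuumCauchyDevelopment (F' c), 𝒟.IsMaximal) ∧
                  ∀ 𝒟 : VacuumCauchyDevelopment (F' c), 𝒟.IsMaximal →
                    Summit.FinalStateConjecture.HasCompleteNullInfinity 𝒟.toCauchyDevelopment) ∧
                ∀ 𝒟 : VacuumCauchyDevelopment (F' c), 𝒟.IsMaximal →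
                  ∀ (L : ℝ) (ε : ℝ≥0∞) (R₀ : ℝ), 0 < L → 0 < ε →
                    ∃ (N : ℕ) (m₀ χ : ℝ), 0 < m₀ ∧ 0 ≤ χ ∧ χ < 1 ∧
                      𝒟.IsAdiabaticallyTracked N m₀ χ ε L R₀)
    (h₂ : ∀ (X : Type) [TopologicalSpace X] [ChartedSpace E3 X] [IsManifold (𝓡 3) ∞ X] [T2Space X]
      [SecondCountableTopology X] [ConnectedSpace X],
      ∀ (e : AFEnd X) (F : EuclideanSpace ℝ (Fin 1) → InitialDataSet (𝓡 3) X),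
        InitialDataSet.IsTameDataFamily e 1 F →
          ((InitialDataSet.IsImmersedAtZero 1 F ∧ Function.Injective F) ∨ ∀ c, F c = F 0) →
          (∀ c, F c ∈ admissibleVacuumData X) →
          (∀ c ≠ 0,
            ((∃ 𝒟 : VacuumCauchyDevelopment (F c), 𝒟.IsMaximal) ∧
              ∀ 𝒟 : VacuumCauchyDevelopment (F c), 𝒟.IsMaximal →
                Summit.FinalStateConjecture.HasCompleteNullInfinity 𝒟.toCauchyDevelopment) ∧
            ∀ 𝒟 : VacuumCauchyDevelopment (F c), 𝒟.IsMaximal →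
              ∀ (L : ℝ) (ε : ℝ≥0∞) (R₀ : ℝ), 0 < L → 0 < ε →
                ∃ (N : ℕ) (m₀ χ : ℝ), 0 < m₀ ∧ 0 ≤ χ ∧ χ < 1 ∧
                  𝒟.IsAdiabaticallyTracked N m₀ χ ε L R₀) →
          ∃ F' : EuclideanSpace ℝ (Fin 1) → InitialDataSet (𝓡 3) X,
            InitialDataSet.IsTameDataFamily e 1 F' ∧ F' 0 = F 0 ∧ Function.Injective F' ∧
              InitialDataSet.IsImmersedAtZero 1 F' ∧ (∀ c, F' c ∈ admissibleVacuumData X) ∧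
              ∀ c : EuclideanSpace ℝ (Fin 1), c ≠ 0 →
                ((∃ 𝒟 : VacuumCauchyDevelopment (F' c), 𝒟.IsMaximal) ∧
                  ∀ 𝒟 : VacuumCauchyDevelopment (F' c), 𝒟.IsMaximal →
                    Summit.FinalStateConjecture.HasCompleteNullInfinity 𝒟.toCauchyDevelopment) ∧
                ∀ 𝒟 : VacuumCauchyDevelopment (F' c), 𝒟.IsMaximal →
                  ∃ (N : ℕ) (m₀ χ : ℝ), 0 < m₀ ∧ 0 ≤ χ ∧ χ < 1 ∧
                    ∀ (L : ℝ) (ε : ℝ≥0∞) (R₀ : ℝ), 0 < L → 0 < ε →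
                      𝒟.IsAdiabaticallyTracked N m₀ χ ε L R₀)
    (h₃ : ∀ (X : Type) [TopologicalSpace X] [ChartedSpace E3 X] [IsManifold (𝓡 3) ∞ X] [T2Space X]
      [SecondCountableTopology X] [ConnectedSpace X],
      ∀ D ∈ admissibleVacuumData X, ∀ 𝒟 : VacuumCauchyDevelopment D, 𝒟.IsMaximal →
        Summit.FinalStateConjecture.HasCompleteNullInfinity 𝒟.toCauchyDevelopment →
          (∃ (N : ℕ) (m₀ χ : ℝ), 0 < m₀ ∧ 0 ≤ χ ∧ χ < 1 ∧
            ∀ (L : ℝ) (ε : ℝ≥0∞) (R₀ : ℝ), 0 < L → 0 < ε → 𝒟.IsAdiabaticallyTracked N m₀ χ ε L R₀) →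
          ∃ (O : Set 𝒟.carrier) (d : FinalStateDecomposition 𝒟.toSpacetime O 2),
            (∀ i, Kerr.IsSubextremal (d.mass i) (d.spin i)) ∧
              O = Summit.FinalStateConjecture.exteriorOf 𝒟.toCauchyDevelopment d.charted ∧
                Summit.FinalStateConjecture.RaysStayInClosure 𝒟.toCauchyDevelopment O ∧
                  Summit.FinalStateConjecture.HasExhaustiveCharts d ∧
                    Summit.FinalStateConjecture.IsFutureOriented d) :
    _root_.FinalStateConjecture := by
  intro X _ _ _ _ _ _
  have h𝓓 : ∀ d ∈ admissibleVacuumData X,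
      ∃ e : AFEnd X, e.IsSoleEnd ∧ ∃ M : ℝ, e.IsStronglyAsymptoticallyFlatDR d M :=
    fun d hd ↦ exists_isSoleEnd_of_mem_admissibleVacuumData hd
  -- tame-generic QUIET: composition along censored curves
  have gQ : InitialDataSet.IsTameChristodoulouGeneric (admissibleVacuumData X)
      (fun D ↦ ((∃ 𝒟 : VacuumCauchyDevelopment D, 𝒟.IsMaximal) ∧
          ∀ 𝒟 : VacuumCauchyDevelopment D, 𝒟.IsMaximal →
            Summit.FinalStateConjecture.HasCompleteNullInfinity 𝒟.toCauchyDevelopment) ∧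
        ∀ 𝒟 : VacuumCauchyDevelopment D, 𝒟.IsMaximal →
          ∀ (L : ℝ) (ε : ℝ≥0∞) (R₀ : ℝ), 0 < L → 0 < ε →
            ∃ (N : ℕ) (m₀ χ : ℝ), 0 < m₀ ∧ 0 ≤ χ ∧ χ < 1 ∧
              𝒟.IsAdiabaticallyTracked N m₀ χ ε L R₀) 1 :=
    InitialDataSet.isTameChristodoulouGeneric_of_relative h𝓓 (h₅ X) (h₁ X)
  -- tame-generic MARGIN: composition along quiet curves
  have gM : InitialDataSet.IsTameChristodoulouGeneric (admissibleVacuumData X)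
      (fun D ↦ ((∃ 𝒟 : VacuumCauchyDevelopment D, 𝒟.IsMaximal) ∧
          ∀ 𝒟 : VacuumCauchyDevelopment D, 𝒟.IsMaximal →
            Summit.FinalStateConjecture.HasCompleteNullInfinity 𝒟.toCauchyDevelopment) ∧
        ∀ 𝒟 : VacuumCauchyDevelopment D, 𝒟.IsMaximal →
          ∃ (N : ℕ) (m₀ χ : ℝ), 0 < m₀ ∧ 0 ≤ χ ∧ χ < 1 ∧
            ∀ (L : ℝ) (ε : ℝ≥0∞) (R₀ : ℝ), 0 < L → 0 < ε →
              𝒟.IsAdiabaticallyTracked N m₀ χ ε L R₀) 1 :=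
    InitialDataSet.isTameChristodoulouGeneric_of_relative h𝓓 gQ (h₂ X)
  -- tame-generic SETTLING: pointwise upgrade by the drift capture
  exact gM.mono fun D hD hM ↦
    ⟨hM.1.1, fun 𝒟 h𝒟 ↦ ⟨hM.1.2 𝒟 h𝒟, h₃ X D hD 𝒟 h𝒟 (hM.1.2 𝒟 h𝒟) (hM.2 𝒟 h𝒟)⟩⟩

/-- **THE CRUX BY NAME from the tame layer.** `CaptureSufficesC2` is the summit under three
hypotheses which are idle as typed since the re-typing; introduce them and conclude with
`finalStateConjecture_of_tameLayer`. The line closes the crux the day its four stubs are theorems.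
[folklore] -/
theorem captureSufficesC2_of_tameLayer :
    (∀ (X : Type) [TopologicalSpace X] [ChartedSpace E3 X] [IsManifold (𝓡 3) ∞ X] [T2Space X]
      [SecondCountableTopology X] [ConnectedSpace X], InitialDataSet.IsTameChristodoulouGeneric
      (admissibleVacuumData X) (fun D ↦ (∃ 𝒟 : VacuumCauchyDevelopment D, 𝒟.IsMaximal) ∧ ∀ 𝒟 :
      VacuumCauchyDevelopment D, 𝒟.IsMaximal → Summit.FinalStateConjecture.HasCompleteNullInfinity
      𝒟.toCauchyDevelopment) 1) →
    (∀ (X : Type) [TopologicalSpace X] [ChartedSpace E3 X] [IsManifold (𝓡 3) ∞ X] [T2Space X]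
      [SecondCountableTopology X] [ConnectedSpace X], ∀ (e : AFEnd X) (F : EuclideanSpace ℝ (Fin 1)
      → InitialDataSet (𝓡 3) X), InitialDataSet.IsTameDataFamily e 1 F →
      ((InitialDataSet.IsImmersedAtZero 1 F ∧ Function.Injective F) ∨ ∀ c, F c = F 0) → (∀ c, F c ∈
      admissibleVacuumData X) → (∀ c ≠ 0, (∃ 𝒟 : VacuumCauchyDevelopment (F c), 𝒟.IsMaximal) ∧ ∀ 𝒟 :
      VacuumCauchyDevelopment (F c), 𝒟.IsMaximal →
      Summit.FinalStateConjecture.HasCompleteNullInfinity 𝒟.toCauchyDevelopment) → ∃ F' :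
      EuclideanSpace ℝ (Fin 1) → InitialDataSet (𝓡 3) X, InitialDataSet.IsTameDataFamily e 1 F' ∧ F'
      0 = F 0 ∧ Function.Injective F' ∧ InitialDataSet.IsImmersedAtZero 1 F' ∧ (∀ c, F' c ∈
      admissibleVacuumData X) ∧ ∀ c : EuclideanSpace ℝ (Fin 1), c ≠ 0 → ((∃ 𝒟 :
      VacuumCauchyDevelopment (F' c), 𝒟.IsMaximal) ∧ ∀ 𝒟 : VacuumCauchyDevelopment (F' c),
      𝒟.IsMaximal → Summit.FinalStateConjecture.HasCompleteNullInfinity 𝒟.toCauchyDevelopment) ∧ ∀ 𝒟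
      : VacuumCauchyDevelopment (F' c), 𝒟.IsMaximal → ∀ (L : ℝ) (ε : ℝ≥0∞) (R₀ : ℝ), 0 < L → 0 < ε →
      ∃ (N : ℕ) (m₀ χ : ℝ), 0 < m₀ ∧ 0 ≤ χ ∧ χ < 1 ∧ 𝒟.IsAdiabaticallyTracked N m₀ χ ε L R₀) →
    (∀ (X : Type) [TopologicalSpace X] [ChartedSpace E3 X] [IsManifold (𝓡 3) ∞ X] [T2Space X]
      [SecondCountableTopology X] [ConnectedSpace X], ∀ (e : AFEnd X) (F : EuclideanSpace ℝ (Fin 1)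
      → InitialDataSet (𝓡 3) X), InitialDataSet.IsTameDataFamily e 1 F →
      ((InitialDataSet.IsImmersedAtZero 1 F ∧ Function.Injective F) ∨ ∀ c, F c = F 0) → (∀ c, F c ∈
      admissibleVacuumData X) → (∀ c ≠ 0, ((∃ 𝒟 : VacuumCauchyDevelopment (F c), 𝒟.IsMaximal) ∧ ∀ 𝒟
      : VacuumCauchyDevelopment (F c), 𝒟.IsMaximal →
      Summit.FinalStateConjecture.HasCompleteNullInfinity 𝒟.toCauchyDevelopment) ∧ ∀ 𝒟 :
      VacuumCauchyDevelopment (F c), 𝒟.IsMaximal → ∀ (L : ℝ) (ε : ℝ≥0∞) (R₀ : ℝ), 0 < L → 0 < ε → ∃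
      (N : ℕ) (m₀ χ : ℝ), 0 < m₀ ∧ 0 ≤ χ ∧ χ < 1 ∧ 𝒟.IsAdiabaticallyTracked N m₀ χ ε L R₀) → ∃ F' :
      EuclideanSpace ℝ (Fin 1) → InitialDataSet (𝓡 3) X, InitialDataSet.IsTameDataFamily e 1 F' ∧ F'
      0 = F 0 ∧ Function.Injective F' ∧ InitialDataSet.IsImmersedAtZero 1 F' ∧ (∀ c, F' c ∈
      admissibleVacuumData X) ∧ ∀ c : EuclideanSpace ℝ (Fin 1), c ≠ 0 → ((∃ 𝒟 :
      VacuumCauchyDevelopment (F' c), 𝒟.IsMaximal) ∧ ∀ 𝒟 : VacuumCauchyDevelopment (F' c),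
      𝒟.IsMaximal → Summit.FinalStateConjecture.HasCompleteNullInfinity 𝒟.toCauchyDevelopment) ∧ ∀ 𝒟
      : VacuumCauchyDevelopment (F' c), 𝒟.IsMaximal → ∃ (N : ℕ) (m₀ χ : ℝ), 0 < m₀ ∧ 0 ≤ χ ∧ χ < 1 ∧
      ∀ (L : ℝ) (ε : ℝ≥0∞) (R₀ : ℝ), 0 < L → 0 < ε → 𝒟.IsAdiabaticallyTracked N m₀ χ ε L R₀) →
    (∀ (X : Type) [TopologicalSpace X] [ChartedSpace E3 X] [IsManifold (𝓡 3) ∞ X] [T2Space X]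
      [SecondCountableTopology X] [ConnectedSpace X], ∀ D ∈ admissibleVacuumData X, ∀ 𝒟 :
      VacuumCauchyDevelopment D, 𝒟.IsMaximal → Summit.FinalStateConjecture.HasCompleteNullInfinity
      𝒟.toCauchyDevelopment → (∃ (N : ℕ) (m₀ χ : ℝ), 0 < m₀ ∧ 0 ≤ χ ∧ χ < 1 ∧ ∀ (L : ℝ) (ε : ℝ≥0∞)
      (R₀ : ℝ), 0 < L → 0 < ε → 𝒟.IsAdiabaticallyTracked N m₀ χ ε L R₀) → ∃ (O : Set 𝒟.carrier) (d :
      FinalStateDecomposition 𝒟.toSpacetime O 2), (∀ i, Kerr.IsSubextremal (d.mass i) (d.spin i)) ∧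
      O = Summit.FinalStateConjecture.exteriorOf 𝒟.toCauchyDevelopment d.charted ∧
      Summit.FinalStateConjecture.RaysStayInClosure 𝒟.toCauchyDevelopment O ∧
      Summit.FinalStateConjecture.HasExhaustiveCharts d ∧
      Summit.FinalStateConjecture.IsFutureOriented d) →
    Summit.FinalStateConjecture.FinalStateConjecture.Theses.PhaseMixingCapture.CaptureSufficesC2 :=
  fun h₅ h₁ h₂ h₃ _ _ _ ↦ finalStateConjecture_of_tameLayer h₅ h₁ h₂ h₃

/-- Hypothesis (1) of the reduction — tame weak cosmic censorship, MGHD form — STRENGTHENS rank 5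
`WeakCosmicCensorshipMGHD` as typed (tame genericity forgets to the topology-free notion,
`IsTameChristodoulouGeneric.isChristodoulouGeneric`): it is rank 5's tame successor, not a new
hypothesis. [folklore] -/
theorem weakCosmicCensorshipMGHD_of_tameCensorship
    (h₅ : ∀ (X : Type) [TopologicalSpace X] [ChartedSpace E3 X] [IsManifold (𝓡 3) ∞ X] [T2Space X]
      [SecondCountableTopology X] [ConnectedSpace X],
      InitialDataSet.IsTameChristodoulouGeneric (admissibleVacuumData X)
        (fun D ↦ (∃ 𝒟 : VacuumCauchyDevelopment D, 𝒟.IsMaximal) ∧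
          ∀ 𝒟 : VacuumCauchyDevelopment D, 𝒟.IsMaximal →
            Summit.FinalStateConjecture.HasCompleteNullInfinity 𝒟.toCauchyDevelopment) 1) :
    WeakCosmicCensorshipMGHD := by
  intro X _ _ _ _ _ _
  exact (h₅ X).isChristodoulouGeneric

/-- Hypothesis (1) of the reduction is NECESSARY: the re-typed summit implies tame weak cosmic
censorship in MGHD form (tame genericity is monotone under pointwise implication,
`IsTameChristodoulouGeneric.mono`). [folklore] -/
theorem tameCensorship_of_finalStateConjecture (h : _root_.FinalStateConjecture) :
    ∀ (X : Type) [TopologicalSpace X] [ChartedSpace E3 X] [IsManifold (𝓡 3) ∞ X] [T2Space X]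
      [SecondCountableTopology X] [ConnectedSpace X],
      InitialDataSet.IsTameChristodoulouGeneric (admissibleVacuumData X)
        (fun D ↦ (∃ 𝒟 : VacuumCauchyDevelopment D, 𝒟.IsMaximal) ∧
          ∀ 𝒟 : VacuumCauchyDevelopment D, 𝒟.IsMaximal →
            Summit.FinalStateConjecture.HasCompleteNullInfinity 𝒟.toCauchyDevelopment) 1 := by
  intro X _ _ _ _ _ _
  exact (h X).mono fun D _ hP ↦ ⟨hP.1, fun 𝒟 h𝒟 ↦ (hP.2 𝒟 h𝒟).1⟩

/-! ## Absolute form: the crux from TAME generic adiabatic tracking, MGHD existence and drift capture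
(the route `RenormalisedDrift` assembly, re-typed tame and repaired, closes this crux) -/

/-- **THE CRUX FROM THE TAME `RenormalisedDrift` LAYER (absolute form of the reduction).** Hypotheses:
(T) tame-Christodoulou-generically in `admissibleVacuumData X`, every MGHD has complete `𝓘⁺` and is
adiabatically tracked at EVERY accuracy with ONE complexity `(N, m₀, χ < 1)` — verbatim the matrix of
item stmt-FinalStateConjecture-10854 `RenormalisedDrift.AdiabaticTracking` (over the landed predicate
`VacuumCauchyDevelopment.IsAdiabaticallyTracked`, definitionally its inlined block) with the summit's
re-typed TAME genericity in place of `IsChristodoulouGeneric`; (E) every admissible datum has an MGHD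
— verbatim item stmt-FinalStateConjecture-9937 `RenormalisedDrift.MGHDExists`; (S₄) pointwise
all-accuracy drift capture — the registered `stub_trackedCaptureSettles` (= item 10853 with the
all-accuracy repair and the audit clauses). Conclusion: `CaptureSufficesC2` (its own three hypotheses
idle). Proof: `IsTameChristodoulouGeneric.mono` with the pointwise upgrade (E) + (S₄). Up to
self-witnesses this is the same layer as `captureSufficesC2_of_tameLayer` (the relative stubs S₂, S₃
plus tame censorship give (T) by two compositions along curves). [folklore] -/
theorem captureSufficesC2_of_tameTracking :
    (∀ (X : Type) [TopologicalSpace X] [ChartedSpace E3 X] [IsManifold (𝓡 3) ∞ X] [T2Space X]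
      [SecondCountableTopology X] [ConnectedSpace X],
      InitialDataSet.IsTameChristodoulouGeneric (admissibleVacuumData X)
        (fun D ↦ ∀ 𝒟 : VacuumCauchyDevelopment D, 𝒟.IsMaximal →
          Summit.FinalStateConjecture.HasCompleteNullInfinity 𝒟.toCauchyDevelopment ∧
            ∃ (N : ℕ) (m₀ χ : ℝ), 0 < m₀ ∧ 0 ≤ χ ∧ χ < 1 ∧
              ∀ (L : ℝ) (ε : ℝ≥0∞) (R₀ : ℝ), 0 < L → 0 < ε →
                𝒟.IsAdiabaticallyTracked N m₀ χ ε L R₀) 1) →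
    (∀ (X : Type) [TopologicalSpace X] [ChartedSpace E3 X] [IsManifold (𝓡 3) ∞ X] [T2Space X]
      [SecondCountableTopology X] [ConnectedSpace X],
      ∀ D ∈ admissibleVacuumData X, ∃ 𝒟 : VacuumCauchyDevelopment D, 𝒟.IsMaximal) →
    (∀ (X : Type) [TopologicalSpace X] [ChartedSpace E3 X] [IsManifold (𝓡 3) ∞ X] [T2Space X]
      [SecondCountableTopology X] [ConnectedSpace X],
      ∀ D ∈ admissibleVacuumData X, ∀ 𝒟 : VacuumCauchyDevelopment D, 𝒟.IsMaximal →
        Summit.FinalStateConjecture.HasCompleteNullInfinity 𝒟.toCauchyDevelopment →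
          (∃ (N : ℕ) (m₀ χ : ℝ), 0 < m₀ ∧ 0 ≤ χ ∧ χ < 1 ∧
            ∀ (L : ℝ) (ε : ℝ≥0∞) (R₀ : ℝ), 0 < L → 0 < ε → 𝒟.IsAdiabaticallyTracked N m₀ χ ε L R₀) →
          ∃ (O : Set 𝒟.carrier) (d : FinalStateDecomposition 𝒟.toSpacetime O 2),
            (∀ i, Kerr.IsSubextremal (d.mass i) (d.spin i)) ∧
              O = Summit.FinalStateConjecture.exteriorOf 𝒟.toCauchyDevelopment d.charted ∧
                Summit.FinalStateConjecture.RaysStayInClosure 𝒟.toCauchyDevelopment O ∧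
                  Summit.FinalStateConjecture.HasExhaustiveCharts d ∧
                    Summit.FinalStateConjecture.IsFutureOriented d) →
    Summit.FinalStateConjecture.FinalStateConjecture.Theses.PhaseMixingCapture.CaptureSufficesC2 := by
  intro hT hE h₃ _ _ _ X _ _ _ _ _ _
  exact (hT X).mono fun D hD hP ↦
    ⟨hE X D hD, fun 𝒟 h𝒟 ↦ ⟨(hP 𝒟 h𝒟).1, h₃ X D hD 𝒟 h𝒟 (hP 𝒟 h𝒟).1 (hP 𝒟 h𝒟).2⟩⟩

/-- The absolute layer gives the SUMMIT outright (no hypothesis of the crux is used): the tame,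
repaired form of the `RenormalisedDrift` assembly `AdiabaticTracking ∧ DriftCapture ∧ MGHDExists →
FinalStateConjecture`. [folklore] -/
theorem finalStateConjecture_of_tameTracking
    (hT : ∀ (X : Type) [TopologicalSpace X] [ChartedSpace E3 X] [IsManifold (𝓡 3) ∞ X] [T2Space X]
      [SecondCountableTopology X] [ConnectedSpace X],
      InitialDataSet.IsTameChristodoulouGeneric (admissibleVacuumData X)
        (fun D ↦ ∀ 𝒟 : VacuumCauchyDevelopment D, 𝒟.IsMaximal →
          Summit.FinalStateConjecture.HasCompleteNullInfinity 𝒟.toCauchyDevelopment ∧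
            ∃ (N : ℕ) (m₀ χ : ℝ), 0 < m₀ ∧ 0 ≤ χ ∧ χ < 1 ∧
              ∀ (L : ℝ) (ε : ℝ≥0∞) (R₀ : ℝ), 0 < L → 0 < ε →
                𝒟.IsAdiabaticallyTracked N m₀ χ ε L R₀) 1)
    (hE : ∀ (X : Type) [TopologicalSpace X] [ChartedSpace E3 X] [IsManifold (𝓡 3) ∞ X] [T2Space X]
      [SecondCountableTopology X] [ConnectedSpace X],
      ∀ D ∈ admissibleVacuumData X, ∃ 𝒟 : VacuumCauchyDevelopment D, 𝒟.IsMaximal)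
    (h₃ : ∀ (X : Type) [TopologicalSpace X] [ChartedSpace E3 X] [IsManifold (𝓡 3) ∞ X] [T2Space X]
      [SecondCountableTopology X] [ConnectedSpace X],
      ∀ D ∈ admissibleVacuumData X, ∀ 𝒟 : VacuumCauchyDevelopment D, 𝒟.IsMaximal →
        Summit.FinalStateConjecture.HasCompleteNullInfinity 𝒟.toCauchyDevelopment →
          (∃ (N : ℕ) (m₀ χ : ℝ), 0 < m₀ ∧ 0 ≤ χ ∧ χ < 1 ∧
            ∀ (L : ℝ) (ε : ℝ≥0∞) (R₀ : ℝ), 0 < L → 0 < ε → 𝒟.IsAdiabaticallyTracked N m₀ χ ε L R₀) →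
          ∃ (O : Set 𝒟.carrier) (d : FinalStateDecomposition 𝒟.toSpacetime O 2),
            (∀ i, Kerr.IsSubextremal (d.mass i) (d.spin i)) ∧
              O = Summit.FinalStateConjecture.exteriorOf 𝒟.toCauchyDevelopment d.charted ∧
                Summit.FinalStateConjecture.RaysStayInClosure 𝒟.toCauchyDevelopment O ∧
                  Summit.FinalStateConjecture.HasExhaustiveCharts d ∧
                    Summit.FinalStateConjecture.IsFutureOriented d) :
    _root_.FinalStateConjecture := by
  intro X _ _ _ _ _ _
  exact (hT X).mono fun D hD hP ↦
    ⟨hE X D hD, fun 𝒟 h𝒟 ↦ ⟨(hP 𝒟 h𝒟).1, h₃ X D hD 𝒟 h𝒟 (hP 𝒟 h𝒟).1 (hP 𝒟 h𝒟).2⟩⟩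

end Summit.FinalStateConjecture.FinalStateConjecture.Theorems.PhaseMixingCaptureCaptureSufficesC2

end
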